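import Summits.ResolutionOfSingularities.ResolutionOfSingularities.Theorems.EquisingularLiftEquisingularLiftNatTowerPtStepsInvThree
import HarnessLib

/-!
# [OURS · L1 W4.5(b) · EL♮(3)] T23-A ENGINE, brick B-AWAY + the running surface's point transport at `Exc₃` level (explicit stage)

res-L1-w45b-stub-4 g10 (T23-A ENGINE OWNER; word `L/res-L1-w45b-stub-4/T23A-ENGINE-WORD.md` 340f00d84dbcbbfc; res-L1-w45b-lead-2 g4's sig draft
`TowerRoundB.sig.lean` 86a5193cfa1b3f6a). Crux EL♮(3) = stmt-ResolutionOfSingularities-20148 (parent stmt-…-20038), route `EquisingularLift`, line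
`sections`. OURS; NOT a statement of any manuscript; AI-written, weaker than expert review. DEF-FREE; no `sorry`; standard axioms;
`--supports stmt-ResolutionOfSingularities-20148 --as helper`.

WHY. The B-tower (planner memo CRUX-PLAN v3.33 §II5) RETAINS older exceptional surfaces `F ∈ Es` through later steps. Upstairs all retained members
live in ONE stage `X` (`Tower.StageB`, …NatTowerInvBDefs): a step blows `X` up along a centre `C` lying over the downstairs centre `D` (a point
`{y}` or a round's curve `Z`), and a retained member must be transported THROUGH THAT SAME BLOW-UP. This file proves the two `Exc₃`-level
transports at an EXPLICIT stage step `τ : X'' → X` (the ₆ bricks conclude `Tower.Inv₃` with the new stage bound under `∃`, unusable for a second member):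
* `disjoint_support_of_inter_fibre_eq_empty` — (E5, general form) over `Spec O` (`O` local) with a universally closed structure map: two closed
  subschemes whose supports do not meet over the closed point do not meet at all.
* `disjoint_support_centre_of_trace` — a member `𝓕` with trace `𝓕·𝒪_G = 𝓘⟨F⟩` misses a centre `C` lying over `jG '' D` when `D ∩ F = ∅`.
* **`Tower.exc₃_transport_away`** (B-AWAY) — a retained member's shadow-forgotten datum `Exc₃ … F hF ∅ X σ jG` passes to
  `Exc₃ … (closure υ₂⁻¹(F ∖ D)) _ ∅ X'' (τ ≫ σ) j₂` through ANY step whose downstairs blow-up `υ₂` has centre support `D`, provided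
  `F` hosts no round (`Tower.NoRound`, then nothing upstairs is needed) or `D ∩ F = ∅` and every upstairs model of `F` misses `C` (iso-transport
  `𝓕 ↦ 𝓕·𝒪_{X''}`: `exists_iso_subscheme_comap_of_disjoint`, trace by `IsBlowup.comap_vanishingIdeal_of_disjoint`, principal / regular / off-generic
  verbatim, the ruled datum by the hypothesis `hRuled` = the iso-invariance every datum of record has — `FE` = O-flatness).
* **`Tower.exc₃_pointCentre_transport`** — the RUNNING surface with its cone shadow through a point step off `E` and off `closure K`
  (`E ↦ closure υ₂⁻¹(E ∖ {pt})`, `K ↦ closure υ₂⁻¹(K ∖ {pt})`): the `Exc₃` content of `Tower.inv₃_pointCentre_transport` (…NatTowerInvThreePointCentre)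
  at the explicit new stage — adapted copy of that proof, conclusion un-packed.
* `Tower.noRound_pointCentre_new` — the new exceptional plane `υ₂⁻¹{pt}` hosts no round (the content of `Tower.inv₃_pointCentre_new`).
References: the cited tree files; [cite: GortzWedhorn2020, Prop. 13.91 (3) and (13.19)]; [cite: StacksProject, Tags 01K0, 02OS, 033B].
-/

set_option linter.dupNamespace false -- mandated namespace `Summit.<Summit>.<Problem>` of this single-conjunct summit

noncomputable section

open CategoryTheory CategoryTheory.Limits AlgebraicGeometry TopologicalSpace Topology IsLocalRing
open Literature.AlgebraicGeometry.Resolution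
open AlgebraicGeometry.Scheme.IdealSheafData
open Summit.ResolutionOfSingularities.ResolutionOfSingularities.Theses.EquisingularLift.Split

namespace Summit.ResolutionOfSingularities.ResolutionOfSingularities.Cruxes.EquisingularLiftNat.Sections

/-! ## (E5, general form) and the member/centre disjointness -/

/-- **(E5, general form)** Over `Spec O`, `O` local, with a universally closed structure map `r : X → Spec O`: if the supports of `I` and `C`
do not meet over the closed point, they do not meet (the closed image of `supp I ∩ supp C` would contain the closed point).
[folklore; cite: StacksProject, Tag 01K0] -/
theorem disjoint_support_of_inter_fibre_eq_empty {O : Type} [CommRing O] [IsLocalRing O] {X : Scheme.{0}}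
    (r : X ⟶ Spec (.of O)) [UniversallyClosed r] (C I : X.IdealSheafData)
    (h : (I.support : Set X) ∩ (C.support : Set X) ∩ r ⁻¹' {IsLocalRing.closedPoint O} = ∅) :
    Disjoint (I.support : Set X) (C.support : Set X) := by
  rw [Set.disjoint_iff_inter_eq_empty]
  by_contra hne
  have hcl : IsClosed (r '' ((I.support : Set X) ∩ (C.support : Set X))) :=
    r.isClosedMap _ (I.support.isClosed.inter C.support.isClosed)
  have hmem : IsLocalRing.closedPoint O ∈ r '' ((I.support : Set X) ∩ (C.support : Set X)) := by
    by_contra hnot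
    have hU : (⟨(r '' ((I.support : Set X) ∩ (C.support : Set X)))ᶜ, hcl.isOpen_compl⟩ :
        Opens (PrimeSpectrum O)) = ⊤ :=
      (IsLocalRing.closed_point_mem_iff).mp hnot
    have h1 := congrArg (fun U : Opens (PrimeSpectrum O) => ((U : Set (PrimeSpectrum O)))ᶜ) hU
    simp only [Opens.coe_mk, compl_compl, Opens.coe_top, Set.compl_univ] at h1
    exact hne (Set.image_eq_empty.mp h1)
  obtain ⟨c, hc, hrc⟩ := hmem
  have : c ∈ (I.support : Set X) ∩ (C.support : Set X) ∩ r ⁻¹' {IsLocalRing.closedPoint O} := ⟨hc, hrc⟩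
  rw [h] at this
  exact this

/-- **A member misses a centre lying over a disjoint closed set.** With `jG : G → X` (the special fibre of `r = σ ≫ q` in the engine),
a closed subscheme `𝓕` with reduced trace `𝓕·𝒪_G = 𝓘⟨F⟩` and a centre `C` whose special points lie in `jG '' D` with `D ∩ F = ∅`
have disjoint supports, `σ ≫ q` being universally closed. [folklore; cite: StacksProject, Tag 01K0] -/
theorem disjoint_support_centre_of_trace {O : Type} [CommRing O] [IsLocalRing O]
    {X G : Scheme.{0}} (r : X ⟶ Spec (.of O)) [UniversallyClosed r] {jG : G ⟶ X}
    (C 𝓕 : X.IdealSheafData) {D F : Set G} (hF : IsClosed F) (hCD : (C.support : Set X) ∩ r ⁻¹' {IsLocalRing.closedPoint O} ⊆ jG '' D)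
    (htr : 𝓕.comap jG = vanishingIdeal (⟨F, hF⟩ : Closeds G)) (hDF : Disjoint D F) :
    Disjoint (𝓕.support : Set X) (C.support : Set X) := by
  refine disjoint_support_of_inter_fibre_eq_empty r C 𝓕 (Set.eq_empty_iff_forall_notMem.mpr ?_)
  rintro c ⟨⟨hcF, hcC⟩, hcr⟩
  obtain ⟨d, hdD, rfl⟩ := hCD ⟨hcC, hcr⟩
  have hdF : d ∈ F := by
    have h1 : d ∈ ((𝓕.comap jG).support : Set G) := by rw [support_comap]; exact hcF
    rw [htr, Scheme.IdealSheafData.coe_support_vanishingIdeal] at h1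
    exact h1
  exact hDF.le_bot ⟨hdD, hdF⟩

/-! ## B-AWAY: a retained member through any step away from it -/

section Away

variable (O : Type) [CommRing O] (k : Type) [Field k] (θ : O →+* k) (P : Scheme.{0}) (q : P ⟶ Spec (.of O)) (Y : Set P)
  (Ruled : Tower.RuledDatum P)
  {F₉ : Scheme.{0}} {Z₉ : Set F₉} {hZ₉ : IsClosed Z₉} {F₁₀ : Scheme.{0}} {υ' : F₁₀ ⟶ F₉}
  {G G' X X'' : Scheme.{0}} {γ : G ⟶ F₁₀} {σ : X ⟶ P} {jG : G ⟶ X}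
  [IsLocallyNoetherian G]
  {τ : X'' ⟶ X} {C : X.IdealSheafData} (hτ : IsBlowup τ C)
  {D : Set G} {υ₂ : G' ⟶ G} {J : G.IdealSheafData} (hυ₂ : IsBlowup υ₂ J) (hJ : (J.support : Set G) = D)
  {j₂ : G' ⟶ X''} (hcomm : j₂ ≫ τ = υ₂ ≫ jG)

include hτ hυ₂ hJ hcomm

/-- **B-AWAY — a retained member through a step away from it, at `Exc₃` level and an explicit stage** (module docstring).
[cite: GortzWedhorn2020, Prop. 13.91 (3) and (13.19)] [cite: StacksProject, Tags 02OS, 033B] [OURS · L1 W4.5b · T23-A engine]; NOT a statement of the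
manuscript. -/
theorem Tower.exc₃_transport_away
    (hRuled : ∀ (F : Set G) (𝓕 : X.IdealSheafData),
      (∃ e : (𝓕.comap τ).subscheme ≅ 𝓕.subscheme, e.hom ≫ 𝓕.subschemeι = (𝓕.comap τ).subschemeι ≫ τ) →
      Ruled F₉ Z₉ hZ₉ F₁₀ υ' G γ F X σ jG 𝓕 → Ruled F₉ Z₉ hZ₉ F₁₀ υ' G' (υ₂ ≫ γ) (closure (υ₂ ⁻¹' (F \ D))) X'' (τ ≫ σ) j₂ (𝓕.comap τ))
    {F : Set G} (hF : IsClosed F) (hExc : Tower.Exc₃ O P q Y Ruled Z₉ hZ₉ υ' G γ F hF ∅ X σ jG)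
    (haway : Tower.NoRound υ' G γ F ∨
      (Disjoint D F ∧ ∀ 𝓕 : X.IdealSheafData, 𝓕.comap jG = vanishingIdeal (⟨F, hF⟩ : Closeds G) →
        Disjoint (𝓕.support : Set X) (C.support : Set X))) :
    ∀ hF' : IsClosed (closure (υ₂ ⁻¹' (F \ D))),
      Tower.Exc₃ O P q Y Ruled Z₉ hZ₉ υ' G' (υ₂ ≫ γ) (closure (υ₂ ⁻¹' (F \ D))) hF' ∅ X'' (τ ≫ σ) j₂ := by
  intro hF'
  have hsub : closure (υ₂ ⁻¹' (F \ D)) ⊆ υ₂ ⁻¹' F :=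
    closure_minimal (fun z hz => hz.1) (hF.preimage υ₂.continuous)
  -- `NoRound` persists under shrinking and pulling back
  have hNR : Tower.NoRound υ' G γ F → Tower.NoRound υ' G' (υ₂ ≫ γ) (closure (υ₂ ⁻¹' (F \ D))) := by
    intro hno
    refine hno.subset ?_
    rintro _ ⟨z, hz, rfl⟩
    exact ⟨υ₂ z, hsub hz, by rw [Scheme.Hom.comp_apply, Scheme.Hom.comp_apply, Scheme.Hom.comp_apply]⟩
  rcases haway with hno | ⟨hDF, hdj⟩
  · exact Or.inl (hNR hno)
  rcases hExc with hno | ⟨𝓕, he1, he2, he3, he4, he5, -⟩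
  · exact Or.inl (hNR hno)
  have hd : Disjoint (𝓕.support : Set X) (C.support : Set X) := hdj 𝓕 he1
  obtain ⟨e, he⟩ := exists_iso_subscheme_comap_of_disjoint hτ 𝓕 hd
  -- downstairs: `closure υ₂⁻¹(F ∖ D) = υ₂⁻¹ F`
  have hFD : F \ D = F := sdiff_eq_left.mpr hDF.symm
  have hcl : closure (υ₂ ⁻¹' (F \ D)) = υ₂ ⁻¹' F := by
    rw [hFD]; exact (hF.preimage υ₂.continuous).closure_eq
  refine Or.inr ⟨𝓕.comap τ, ?_, fun z => isPrincipal_stalkIdeal_comap τ 𝓕 z (he2 (τ z)),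
    isRegular_subscheme_comap_of_disjoint hτ 𝓕 hd he3, ?_, hRuled F 𝓕 ⟨e, he⟩ he5, Or.inl rfl⟩
  · -- (e-i) the trace: pull the reduced ideal of `F` back along `υ₂` (disjoint from the centre `D = supp J`)
    have hdisj : Disjoint ((⟨F, hF⟩ : Closeds G) : Set G) (J.support : Set G) := by rw [hJ]; exact hDF.symm
    rw [← Scheme.IdealSheafData.comap_comp, hcomm, Scheme.IdealSheafData.comap_comp, he1,
      hυ₂.comap_vanishingIdeal_of_disjoint _ hdisj]
    congr 1
    exact Closeds.ext hcl.symm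
  · -- (e-iv) off the generic point of `Y`
    rintro _ ⟨z, hz, rfl⟩
    have hz' : τ z ∈ (𝓕.support : Set X) := by rw [support_comap] at hz; exact hz
    rw [Scheme.Hom.comp_apply]
    exact he4 ⟨τ z, hz', rfl⟩

end Away

/-! ## The running surface through a point step at `Exc₃` level (shadow carried) -/

section PointCentre

variable (O : Type) [CommRing O] (k : Type) [Field k] (θ : O →+* k) (P : Scheme.{0}) (q : P ⟶ Spec (.of O)) (Y : Set P)
  (Ruled : Tower.RuledDatum P)
  {F₉ : Scheme.{0}} {Z₉ : Set F₉} {hZ₉ : IsClosed Z₉} {F₁₀ : Scheme.{0}} {υ' : F₁₀ ⟶ F₉}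
  {G G' X X'' : Scheme.{0}} {γ : G ⟶ F₁₀} {E K : Set G}
  (hEcl : IsClosed E)
  {σ : X ⟶ P} {jG : G ⟶ X}
  (hExc : ∀ hE : IsClosed E, Tower.Exc₃ O P q Y Ruled Z₉ hZ₉ υ' G γ E hE K X σ jG)
  {pt : G} {D : G.IdealSheafData} (hD : (D.support : Set G) = {pt})
  {υ₂ : G' ⟶ G} (hυ₂ : IsBlowup υ₂ D) [IsLocallyNoetherian G] [IsLocallyNoetherian X] [IsLocallyNoetherian X'']
  {τ : X'' ⟶ X} {C : X.IdealSheafData} (hτ : IsBlowup τ C)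
  (hdisj : ∀ I : X.IdealSheafData, jG pt ∉ (I.support : Set X) → Disjoint (I.support : Set X) (C.support : Set X))
  {j₂ : G' ⟶ X''} {t₂ : G' ⟶ Spec (.of k)} (hcomm : j₂ ≫ τ = υ₂ ≫ jG)
  (hsq₂ : IsPullback j₂ t₂ ((τ ≫ σ) ≫ q) (Spec.map (CommRingCat.ofHom θ)))

omit [IsLocallyNoetherian G] in
/-- **The new exceptional plane hosts no round**: `υ₂⁻¹{pt}` maps to the single point `(γ ≫ υ') pt` of the carrier stage.
[cite: Liu2002, §8.1 and Thm. 8.1.19] [OURS · L1 W4.5b] -/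
theorem Tower.noRound_pointCentre_new : Tower.NoRound υ' G' (υ₂ ≫ γ) (υ₂ ⁻¹' ({pt} : Set G)) := by
  refine (Set.finite_singleton ((γ ≫ υ') pt)).subset ?_
  rintro _ ⟨z, hz, rfl⟩
  rw [Set.mem_preimage, Set.mem_singleton_iff] at hz
  rw [Set.mem_singleton_iff, Scheme.Hom.comp_apply, Scheme.Hom.comp_apply, Scheme.Hom.comp_apply, hz]

include hEcl hExc hD hυ₂ hτ hdisj hcomm hsq₂ in
/-- **The running surface with its cone shadow through a point step off `E` and off `closure K`, at `Exc₃` level and at the explicit new stage**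
(`E ↦ closure υ₂⁻¹(E ∖ {pt})`, `K ↦ closure υ₂⁻¹(K ∖ {pt})`; `𝓔, 𝒦 ↦ ·.comap τ`): the `Exc₃` content of `Tower.inv₃_pointCentre_transport`, adapted copy of
its proof. [cite: GortzWedhorn2020, Prop. 13.91 (3) and (13.19)] [cite: StacksProject, Tags 01WS, 033B] [OURS · L1 W4.5b · T23-A engine]; NOT a statement
of the manuscript. -/
theorem Tower.exc₃_pointCentre_transport
    (hRuled : ∀ (G₀ G₀' : Scheme.{0}) (γ₀ : G₀ ⟶ F₁₀) (E₀ : Set G₀) (X₀ X₀'' : Scheme.{0}) (σ₀ : X₀ ⟶ P) (j₀ : G₀ ⟶ X₀)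
        (j₀' : G₀' ⟶ X₀'') (t₀' : G₀' ⟶ Spec (.of k)) (𝓔₀ : X₀.IdealSheafData) (τ₀ : X₀'' ⟶ X₀) (υ₀ : G₀' ⟶ G₀) (y₀ : G₀),
      j₀' ≫ τ₀ = υ₀ ≫ j₀ → IsPullback j₀' t₀' ((τ₀ ≫ σ₀) ≫ q) (Spec.map (CommRingCat.ofHom θ)) → y₀ ∉ E₀ →
      (∃ e : (𝓔₀.comap τ₀).subscheme ≅ 𝓔₀.subscheme, e.hom ≫ 𝓔₀.subschemeι = (𝓔₀.comap τ₀).subschemeι ≫ τ₀) →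
      Ruled F₉ Z₉ hZ₉ F₁₀ υ' G₀ γ₀ E₀ X₀ σ₀ j₀ 𝓔₀ →
      Ruled F₉ Z₉ hZ₉ F₁₀ υ' G₀' (υ₀ ≫ γ₀) (closure (υ₀ ⁻¹' (E₀ \ {y₀}))) X₀'' (τ₀ ≫ σ₀) j₀' (𝓔₀.comap τ₀))
    (hE : Tower.NoRound υ' G γ E ∨ pt ∉ E) (hK : K = ∅ ∨ pt ∉ closure K) :
    ∀ hE' : IsClosed (closure (υ₂ ⁻¹' (E \ {pt}))),
      Tower.Exc₃ O P q Y Ruled Z₉ hZ₉ υ' G' (υ₂ ≫ γ) (closure (υ₂ ⁻¹' (E \ {pt}))) hE' (closure (υ₂ ⁻¹' (K \ {pt}))) X'' (τ ≫ σ) j₂ := by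
  intro hE'
  have hE'sub : closure (υ₂ ⁻¹' (E \ {pt})) ⊆ υ₂ ⁻¹' E :=
    closure_minimal (fun z hz => hz.1) (hEcl.preimage υ₂.continuous)
  -- `NoRound` persists
  have hNR : Tower.NoRound υ' G γ E → Tower.NoRound υ' G' (υ₂ ≫ γ) (closure (υ₂ ⁻¹' (E \ {pt}))) := by
    intro hno
    refine hno.subset ?_
    rintro _ ⟨z, hz, rfl⟩
    exact ⟨υ₂ z, hE'sub hz, by rw [Scheme.Hom.comp_apply, Scheme.Hom.comp_apply, Scheme.Hom.comp_apply]⟩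
  rcases hE with hno | hyE
  · exact Or.inl (hNR hno)
  rcases hExc hEcl with hno | ⟨𝓔, he1, he2, he3, he4, he5, hSh⟩
  · exact Or.inl (hNR hno)
  -- the round-ready branch: transport `𝓔` (its trace is global, so it misses the centre)
  have he1' : 𝓔.comap jG = vanishingIdeal (⟨closure E, isClosed_closure⟩ : Closeds G) := by
    rw [he1]; congr 1; exact Closeds.ext hEcl.closure_eq.symm
  have hyE' : pt ∉ closure E := by rwa [hEcl.closure_eq]
  obtain ⟨hd𝓔, he, -, hregT, hprinc, htrace⟩ := fatPointStep_transport hτ hcomm hυ₂ hD hdisj 𝓔 E he1' hyE'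
  obtain ⟨e𝓔, he𝓔⟩ := he
  refine Or.inr ⟨𝓔.comap τ, htrace, fun z => hprinc z (he2 (τ z)), hregT he3, ?_, ?_, ?_⟩
  · rintro _ ⟨z, hz, rfl⟩
    have hz' : τ z ∈ (𝓔.support : Set X) := by rw [support_comap] at hz; exact hz
    rw [Scheme.Hom.comp_apply]
    exact he4 ⟨τ z, hz', rfl⟩
  · exact hRuled G G' γ E X X'' σ jG j₂ t₂ 𝓔 τ υ₂ pt hcomm hsq₂ hyE ⟨e𝓔, he𝓔⟩ he5
  · -- the cone shadow with the LOCALIZED trace; the cone may meet the centre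
    rcases hK with hK0 | hyK
    · left
      rw [hK0, Set.empty_sdiff, Set.preimage_empty, closure_empty]
    rcases hSh with hK0 | ⟨𝒦, hk1, ⟨V, hEV, hk2⟩, hk3, hk4, hk5, hk6⟩
    · left
      rw [hK0, Set.empty_sdiff, Set.preimage_empty, closure_empty]
    refine Or.inr ⟨𝒦.comap τ, fun z => isPrincipal_stalkIdeal_comap τ 𝒦 z (hk1 (τ z)), ⟨υ₂ ⁻¹ᵁ V, ?_, ?_⟩, ?_, ?_, ?_, ?_⟩
    · exact hE'sub.trans (Set.preimage_mono hEV)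
    · rw [comap_comap_comap_ι_eq_of_loc hcomm hυ₂ hD 𝒦 K V hk2 hyK]
      congr 2
      exact Closeds.ext closure_closure.symm
    · rw [← Scheme.IdealSheafData.comap_sup]
      have hdEK : Disjoint (((𝓔 ⊔ 𝒦).support : Set X)) (C.support : Set X) :=
        hd𝓔.mono_left (Scheme.IdealSheafData.support_antitone (le_sup_left : 𝓔 ≤ 𝓔 ⊔ 𝒦))
      obtain ⟨e', he'⟩ := exists_iso_subscheme_comap_of_disjoint hτ (𝓔 ⊔ 𝒦) hdEK
      have hfac : ((𝓔 ⊔ 𝒦).comap τ).subschemeι ≫ (τ ≫ σ) ≫ q = e'.hom ≫ ((𝓔 ⊔ 𝒦).subschemeι ≫ σ ≫ q) := by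
        rw [← Category.assoc e'.hom, he', Category.assoc, Category.assoc]
      rw [hfac]
      haveI := hk3
      infer_instance
    · exact Tower.shadow_conditionalRegularity_transport_loc hτ hcomm hυ₂ hD 𝓔 𝒦 hd𝓔 hEcl hyE hyK he1 hEV hk2 hk4 hE'
    · exact isEffectiveCartier_comap_comap_subschemeι_of_disjoint_left hτ 𝓔 𝒦 hd𝓔 he2 hk1 hk5
    · have h1 : (𝒦.comap τ).comap (𝓔.comap τ).subschemeι = (𝒦.comap 𝓔.subschemeι).comap e𝓔.hom := by
        rw [← Scheme.IdealSheafData.comap_comp, ← Scheme.IdealSheafData.comap_comp, he𝓔]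
      rw [h1]
      exact hk6.comap_of_isOpenImmersion e𝓔.hom

end PointCentre

end Summit.ResolutionOfSingularities.ResolutionOfSingularities.Cruxes.EquisingularLiftNat.Sections

end
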